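import Literature.MathematicalPhysics.QuantumFieldTheory.Balaban1983to89.B10Eq13RegularityClaims
import Literature.MathematicalPhysics.QuantumFieldTheory.Balaban1983to89.BlockAveragingFederbushGValued

/-!
# `Balaban1983to89.B10Eq13Enlargement` — T. Bałaban, *Ultraviolet stability of three-dimensional lattice pure
# gauge field theories*, Commun. Math. Phys. **102** (1985) 255–275 [Balaban1985UV3]: the ENLARGEMENT OF THE REGION
# OF INTEGRATION behind the cut-off `χ′` of (13) p. 259 and of (49)–(51) p. 268 — «V′ = e^{iA′}, |A′| < 2·(bound on
# |V′ − 1|)» through the logarithm (21) of [4], PROVED (theorems only)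

statement-level skeleton of published theorems with citation tags; proofs where landed; nothing here is a claim
about the Yang–Mills mass gap

PDF held: `paper:balaban1985-cmp102-uv-stability-3d` (journal page = PDF page + 254); p. 259 [PDF 5] read from the
x2 render `pub-balaban/b2b-balaban-ref1/pages/1985-cmp102-uv-stability-3d/1985-cmp102-uv-stability-3d-p005-x2.png`
and p. 268 [PDF 14] from the held text layer `p0014.txt` (both re-read by this seat, 2026-08-21).  "[4]" = T. Bałaban,
*Averaging operations for lattice gauge theories*, CMP **98** (1985) [Balaban1985Averaging] (B7): the series
logarithm (21) p. 21 and its bound (26) p. 22 `|log X| ≤ 2|X − 1|` (`|X − 1| ≤ ½`) are the tree's `MatrixLog.mlog`,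
`MatrixLog.exp_mlog`, `MatrixLog.norm_mlog_le_two_mul`; (22)–(23) p. 21 «log of a unitary is i·(hermitian)» is
`B7Prop2Explicit.star_mlog_eq_neg`.  "[6]" = *Spaces of regular gauge field configurations …*, CMP **99** (1985)
[Balaban1985RegularSpaces] (B8), Lemma 1 — used here only through p29's kernel theorems
`B10Eq13RegularityClaims.claim259` / `claim259_unitary` / `claim268` (imported BY NAME, nothing re-proved).

WHAT IS REPRODUCED.  Mega-formalization `lit-balaban` (HOME `run/shared/lean/pub/lit-balaban/`), unit
`lit-balaban-r07` gen 14 (B10 fold owner; TAKING line HOME/STATUS.md 2026-08-21T22:04:30Z).  SKELETON rows: **B10.Eq49**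
(row of record, p. 268 sentence) and the proof-narrative displays E13/E18 of `lit-balaban-r07/ROWS-B10.md` §2 (the
cut-off `χ′` of (13), p. 259).  The p. 259 / p. 268 sentences have two clauses: the BOUND «|V′ − 1| < 8·3²L²B₃g₀p(g₀)»
(resp. «|V′_k − 1| < 16·3²L²B₃g_kp(g_k)»), kernel-proved on the `ℤᵈ` block pairs by p29 (`claim259`, `claim268`, from
Lemma 1 of [6]), and the ENLARGEMENT «V′ = e^{iA′}, |A′| < 16·3²L²B₃g₀p(g₀)» (resp. `32·3²`), which p29's header records
as «It is this bound that makes the enlarged region χ′ … contain the support» WITHOUT a theorem.  This file proves the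
enlargement clause and knits it to p29's bounds.

THE PRINTED TEXT.  p. 259 (verbatim, render p005-x2): *"… and the lemma yields the bound |V′ − 1| < 8·3²L²B₃g₀p(g₀)
for g₀ sufficiently small. We enlarge the region of integration to all configurations V′ = e^{iA′} satisfying
|A′| < 16·3²L²B₃g₀p(g₀) on Ω₁."*, and in (13): *"χ′ = ∏_{b∈Ω₁} χ({|A′(b)| < 16·3²L²B₃g₀p(g₀)})"*; p. 260: *"dU′ =
σ(A′)dA′"* (the variables `A′` are the exponential coordinates of `U′ = V′`).  p. 268 (verbatim, text layer p0014):
*"The restrictions on V_k and V^{(k)} imply that the configuration V′_k − 1 is small, more exactly |V′_k − 1| <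
16·3²L²B₃g_kp(g_k). The integration is expressed now in terms of the variables V′_k = e^{iA′}. We enlarge the region
of integration to all configurations V′_k satisfying |A′| < 32·3²L²B₃g_kp(g_k), and we denote by χ′ the
characteristic function of this region."*

THE ARGUMENT FORMALISED ([folklore] mechanism, located at the two sentences).  For one bond variable `v = V′_b` with
`|v − 1| < c ≤ ½`: `A′ := (1/i) log v = (−i)·log v` satisfies `e^{iA′} = e^{log v} = v` ((21) of [4] inverts `exp` on
`|v − 1| < 1`) and `|A′| = |log v| ≤ 2|v − 1| < 2c` ((26) of [4]) — print's DOUBLING `8·3² ↦ 16·3²` (p. 259),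
`16·3² ↦ 32·3²` (p. 268); for unitary `v` with `|v − 1| ≤ ¼` the coordinate `A′` is SELF-ADJOINT ((22)–(23) of [4]:
`(log v)⋆ = −log v`), i.e. `A′ ∈ 𝔤` in the `U(N)` reading, and on every LOG-CHARTED closed `G ⊂ U(N)` (the tree's
`LogChart`, B12 §0 reading of «G a Lie subgroup of U(N)»; every closed linear group is one:
`LogChartClosedSubgroup.closedSubgroupLogChart`) `iA′ = log v ∈ 𝔤` (`LogChart.mlog_mem`).  Hence, bond by bond, the
region `{V′ : |V′_b − 1| < c ∀ b}` is CONTAINED in print's enlarged region `{V′ : V′_b = e^{iA′_b}, |A′_b| < 2c ∀ b}`,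
so for a non-negative integrand the integral over the enlarged region dominates («we enlarge the region of
integration»: an upper bound, as (13)/(51) are).

WHAT THIS FILE PROVES (theorems only; kernel, 0 sorry, standard axioms; no definition, no new named fact):
* §1 ONE BOND VARIABLE, any complete normed `ℂ`-algebra: `I_smul_negI_smul`, `norm_negI_smul` (algebra of `(1/i)`),
  **`exp_I_smul_logCoord`** (`e^{i·((−i)log v)} = v` for `|v − 1| < 1`), **`norm_logCoord_le`** (`|(−i)log v| ≤
  2|v − 1|` for `|v − 1| ≤ ½`), `norm_logCoord_lt` (`|v − 1| < c ≤ ½ ⇒ |A′| < 2c`); C⋆-algebras (print's `G ⊂ U(N)`):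
  **`star_logCoord`** (`v` unitary, `|v − 1| ≤ ¼ ⇒ A′⋆ = A′`); log-charted groups: **`I_smul_logCoord_mem_lie`**
  (`v ∈ G`, `|v − 1| ≤ ρ_G ⇒ iA′ ∈ 𝔤`).
* §2 THE REGION INCLUSION for configurations read through bond variables `V : X → β → 𝔄` (`X` = print's integration
  space of the fluctuation field, `β` = bonds, `S ⊆ β` = the bonds of `Ω₁`, resp. `B(Λ_{k+1})`): `enlarge_pointwise`,
  **`region_subset_enlarged`** (`{x : |V x b − 1| < c on S} ⊆ {x : ∀ b ∈ S, ∃ A, e^{iA} = V x b ∧ |A| < 2c}`),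
  `region_subset_logCut` (`⊆ {x : |(−i) log (V x b)| < 2c on S}` — the cut-off `χ′` read in the log coordinate),
  the unitary and log-charted refinements `region_subset_enlarged_selfAdjoint` / `region_subset_enlarged_lie`
  (`∃ A` with `A⋆ = A`, resp. `iA ∈ 𝔤`), and **«WE ENLARGE THE REGION OF INTEGRATION»**:
  **`indicator_le_indicator_enlarged`** (`χ_{old}·F ≤ χ_{enlarged}·F` pointwise for `F ≥ 0`) and
  **`lintegral_region_le_enlarged`** (`∫_{old} F dμ ≤ ∫_{enlarged} F dμ` for every measure `μ` on `X` and every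
  `ℝ≥0∞`-valued integrand — no measurability needed).
* §3 THE TWO B10 SENTENCES END TO END on the `ℤᵈ` block pairs of p29's `B10Eq13RegularityClaims` (fluctuation field
  `V′ = UU₁⁻¹ = pert U U₁`): **`claim259_enlarged`** (p. 259: under `claim259`'s hypotheses + «g₀ sufficiently small»
  as `8d²L²B₃ε ≤ ½`: every bond variable of the pair is `e^{iA′}` with `|A′| < 16d²L²B₃ε`), `claim259_enlarged_d3`
  (the printed `16·3²`), **`claim259_enlarged_unitary`** (unitary-valued fields: `A′` self-adjoint, smallness
  `8d²L²B₃ε ≤ ¼`), `claim259_enlarged_lie` (log-charted `G`: `iA′ ∈ 𝔤`), **`claim268_enlarged`** /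
  `claim268_enlarged_d3` (p. 268: `|A′| < 32d²L²B₃ε`, printed `32·3²`).
HONEST SCOPE.  (i) `A′` is print's exponential coordinate `(1/i) log V′` taken with the SERIES logarithm (21) of [4]
(the one the cell uses throughout B7–B10); (ii) the smallness provisos `8d²L²B₃ε ≤ ½` (resp. `¼`, resp. `≤ ρ_G`) are
print's «for g₀ sufficiently small» made explicit; (iii) the change of variables `dU′ = σ(A′)dA′` of p. 260 and the
density `σ` are NOT formalised here (narrative display E18; SU(2) density in `B10Eq22Rescaling` §7) — the enlargement
is proved as a statement about regions of the `V′`-space and their indicator functions/integrals, which is what the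
inequality sign of (13)/(51) uses; (iv) model deviations of the `ℤᵈ` knits are those of `B10Eq13RegularityClaims`
(M1)–(M6).  NOT summit progress.
-/

noncomputable section

open scoped ENNReal
open NormedSpace MeasureTheory

namespace Literature.MathematicalPhysics.QuantumFieldTheory.Balaban1983to89.B10Eq13Enlargement

open MatrixLog B7Prop1Explicit B7Prop2Explicit B8Lemma1NonAbelian B10Eq13RegularityClaims

-- `Site` alone could resolve to the torus sites of `Setup.lean`; re-export the `ℤ^d` sites of `B7Prop1Explicit`.
export B7Prop1Explicit (Site)

/-! ## §1 One bond variable: the exponential coordinate `A′ = (1/i) log V′` -/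

section OneBond

variable {𝔄 : Type*} [NormedRing 𝔄] [NormedAlgebra ℂ 𝔄]

/-- `i·((1/i)·X) = X` (`1/i = −i`). [cite: Balaban1985UV3, (13) p.259] -/
theorem I_smul_negI_smul (X : 𝔄) : (Complex.I : ℂ) • ((-Complex.I : ℂ) • X) = X := by
  rw [smul_smul, mul_neg, Complex.I_mul_I, neg_neg, one_smul]

/-- `|(1/i)·X| = |X|`. [cite: Balaban1985UV3, (13) p.259] -/
theorem norm_negI_smul (X : 𝔄) : ‖(-Complex.I : ℂ) • X‖ = ‖X‖ := by
  rw [norm_smul, norm_neg, Complex.norm_I, one_mul]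

variable [CompleteSpace 𝔄]

/-- **`V′ = e^{iA′}` with `A′ = (1/i) log V′`** — for a bond variable `v` with `|v − 1| < 1` the series logarithm (21)
of [4] inverts the exponential: `exp (i·((−i)·log v)) = exp (log v) = v` (`MatrixLog.exp_mlog`).
[cite: Balaban1985UV3, (13) p.259] -/
theorem exp_I_smul_logCoord {v : 𝔄} (hv : ‖v - 1‖ < 1) :
    exp ((Complex.I : ℂ) • ((-Complex.I : ℂ) • mlog v)) = v := by
  rw [I_smul_negI_smul]
  exact exp_mlog hv

/-- **`|A′| ≤ 2|V′ − 1|`** for `|V′ − 1| ≤ ½` — (26) of [4] (`MatrixLog.norm_mlog_le_two_mul`); this is print's doubling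
of the constants `8·3² ↦ 16·3²` (p. 259) and `16·3² ↦ 32·3²` (p. 268). [cite: Balaban1985UV3, (13) p.259] -/
theorem norm_logCoord_le {v : 𝔄} (hv : ‖v - 1‖ ≤ 1 / 2) :
    ‖(-Complex.I : ℂ) • mlog v‖ ≤ 2 * ‖v - 1‖ := by
  rw [norm_negI_smul]
  exact norm_mlog_le_two_mul hv

/-- `|V′ − 1| < c ≤ ½ ⇒ |A′| < 2c`. [cite: Balaban1985UV3, (13) p.259] -/
theorem norm_logCoord_lt {v : 𝔄} {c : ℝ} (hv : ‖v - 1‖ < c) (hc : c ≤ 1 / 2) :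
    ‖(-Complex.I : ℂ) • mlog v‖ < 2 * c := by
  have h := norm_logCoord_le (v := v) (by linarith)
  linarith

/-- the two facts together: `|v − 1| < c ≤ ½ ⇒ e^{iA′} = v ∧ |A′| < 2c` with `A′ = (−i) log v`.
[cite: Balaban1985UV3, (13) p.259] -/
theorem exp_logCoord_and_norm_lt {v : 𝔄} {c : ℝ} (hv : ‖v - 1‖ < c) (hc : c ≤ 1 / 2) :
    exp ((Complex.I : ℂ) • ((-Complex.I : ℂ) • mlog v)) = v ∧ ‖(-Complex.I : ℂ) • mlog v‖ < 2 * c :=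
  ⟨exp_I_smul_logCoord (by linarith), norm_logCoord_lt hv hc⟩

end OneBond

section CStar

variable {𝔄 : Type*} [CStarAlgebra 𝔄]

/-- **`A′` IS SELF-ADJOINT for a unitary bond variable** (print's `G ⊂ U(N)`, `A′` with values in the hermitian
matrices `𝔤 ⊂ 𝔲(N)/i`): for `v⋆v = vv⋆ = 1` and `|v − 1| ≤ ¼`, `((−i) log v)⋆ = (−i) log v` — from (22)–(23) of [4]
in the form `B7Prop2Explicit.star_mlog_eq_neg` (`(log v)⋆ = −log v`). [cite: Balaban1985UV3, (13) p.259] -/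
theorem star_logCoord {v : 𝔄} (hv : v ∈ unitary 𝔄) (h : ‖v - 1‖ ≤ 1 / 4) :
    star ((-Complex.I : ℂ) • mlog v) = (-Complex.I : ℂ) • mlog v := by
  rw [star_smul, star_mlog_eq_neg hv h, Complex.star_def, map_neg, Complex.conj_I, neg_neg, smul_neg, neg_smul]

/-- the self-adjoint coordinate, as membership in Mathlib's `selfAdjoint`. [cite: Balaban1985UV3, (13) p.259] -/
theorem logCoord_mem_selfAdjoint {v : 𝔄} (hv : v ∈ unitary 𝔄) (h : ‖v - 1‖ ≤ 1 / 4) :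
    (-Complex.I : ℂ) • mlog v ∈ selfAdjoint 𝔄 :=
  (selfAdjoint.mem_iff).2 (star_logCoord hv h)

end CStar

section Chart

variable {𝔄 : Type*} [NormedRing 𝔄] [NormedAlgebra ℂ 𝔄]

/-- **`iA′ ∈ 𝔤` on every log-charted group** (print: «semi-simple compact Lie group G», a Lie subgroup of `U(N)` —
the tree's `LogChart` data of `BlockAveragingFederbushGValued`; every closed linear group carries one,
`LogChartClosedSubgroup.closedSubgroupLogChart`): for `v ∈ G` with `|v − 1| ≤ ρ_G`, `i·((−i) log v) = log v ∈ 𝔤`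
(the chart's axiom `mlog_mem`, [Hall2015] Thm 3.42). [cite: Balaban1985UV3, (13) p.259] -/
theorem I_smul_logCoord_mem_lie (G : LogChart 𝔄) {v : 𝔄} (hv : v ∈ G.carrier) (h : ‖v - 1‖ ≤ G.ρ) :
    (Complex.I : ℂ) • ((-Complex.I : ℂ) • mlog v) ∈ G.lie := by
  rw [I_smul_negI_smul]
  exact G.mlog_mem hv h

end Chart

/-! ## §2 The region inclusion and «we enlarge the region of integration» -/

section Region

variable {X β 𝔄 : Type*} [NormedRing 𝔄] [NormedAlgebra ℂ 𝔄] [CompleteSpace 𝔄]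

/-- POINTWISE: a configuration whose bond variables on `S` are `c`-close to `1` (`c ≤ ½`) has, on every bond of `S`,
`V_b = e^{iA′_b}` with `A′_b = (−i) log V_b` and `|A′_b| < 2c`. [cite: Balaban1985UV3, (13) p.259] -/
theorem enlarge_pointwise (V : X → β → 𝔄) {S : Set β} {c : ℝ} (hc : c ≤ 1 / 2) {x : X}
    (hx : ∀ b ∈ S, ‖V x b - 1‖ < c) :
    ∀ b ∈ S, exp ((Complex.I : ℂ) • ((-Complex.I : ℂ) • mlog (V x b))) = V x b ∧
      ‖(-Complex.I : ℂ) • mlog (V x b)‖ < 2 * c :=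
  fun b hb => exp_logCoord_and_norm_lt (hx b hb) hc

/-- **THE REGION INCLUSION** (p. 259 after (13), p. 268 before (50)): the region `{|V′_b − 1| < c, b ∈ S}` is contained
in print's enlarged region «all configurations V′ = e^{iA′} satisfying |A′| < 2c» on `S`, for `c ≤ ½`.
[cite: Balaban1985UV3, (13) p.259] -/
theorem region_subset_enlarged (V : X → β → 𝔄) (S : Set β) {c : ℝ} (hc : c ≤ 1 / 2) :
    {x : X | ∀ b ∈ S, ‖V x b - 1‖ < c} ⊆
      {x : X | ∀ b ∈ S, ∃ A : 𝔄, exp ((Complex.I : ℂ) • A) = V x b ∧ ‖A‖ < 2 * c} := by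
  intro x hx b hb
  exact ⟨(-Complex.I : ℂ) • mlog (V x b), enlarge_pointwise V hc hx b hb⟩

/-- the same inclusion with the cut-off read in the logarithmic coordinate: `{|V′_b − 1| < c on S} ⊆ {|(1/i) log V′_b|
< 2c on S}` — the region of `χ′ = ∏_b χ({|A′(b)| < 2c})` of (13). [cite: Balaban1985UV3, (13) p.259] -/
theorem region_subset_logCut (V : X → β → 𝔄) (S : Set β) {c : ℝ} (hc : c ≤ 1 / 2) :
    {x : X | ∀ b ∈ S, ‖V x b - 1‖ < c} ⊆ {x : X | ∀ b ∈ S, ‖(-Complex.I : ℂ) • mlog (V x b)‖ < 2 * c} :=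
  fun _ hx b hb => (enlarge_pointwise V hc hx b hb).2

/-- **«WE ENLARGE THE REGION OF INTEGRATION»** at the level of characteristic functions: for a non-negative integrand
`F`, `χ({|V′_b − 1| < c ∀ b ∈ S})·F ≤ χ(enlarged region)·F` pointwise. [cite: Balaban1985UV3, (13) p.259] -/
theorem indicator_le_indicator_enlarged (V : X → β → 𝔄) (S : Set β) {c : ℝ} (hc : c ≤ 1 / 2) {F : X → ℝ}
    (hF : ∀ x, 0 ≤ F x) (x : X) :
    {x : X | ∀ b ∈ S, ‖V x b - 1‖ < c}.indicator F x ≤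
      {x : X | ∀ b ∈ S, ∃ A : 𝔄, exp ((Complex.I : ℂ) • A) = V x b ∧ ‖A‖ < 2 * c}.indicator F x :=
  Set.indicator_le_indicator_of_subset (region_subset_enlarged V S hc) hF x

/-- **«WE ENLARGE THE REGION OF INTEGRATION»** at the level of integrals: for EVERY measure `μ` on the configuration
space and every non-negative (`ℝ≥0∞`-valued) integrand, the integral over `{|V′_b − 1| < c, b ∈ S}` is at most the
integral over print's enlarged region — the inequality sign of (13) and of (51). [cite: Balaban1985UV3, (13) p.259] -/
theorem lintegral_region_le_enlarged [MeasurableSpace X] (μ : Measure X) (V : X → β → 𝔄) (S : Set β) {c : ℝ}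
    (hc : c ≤ 1 / 2) (F : X → ℝ≥0∞) :
    ∫⁻ x in {x : X | ∀ b ∈ S, ‖V x b - 1‖ < c}, F x ∂μ ≤
      ∫⁻ x in {x : X | ∀ b ∈ S, ∃ A : 𝔄, exp ((Complex.I : ℂ) • A) = V x b ∧ ‖A‖ < 2 * c}, F x ∂μ :=
  lintegral_mono_set (region_subset_enlarged V S hc)

/-- the integral form with the logarithmic cut-off region of `χ′`. [cite: Balaban1985UV3, (13) p.259] -/
theorem lintegral_region_le_logCut [MeasurableSpace X] (μ : Measure X) (V : X → β → 𝔄) (S : Set β) {c : ℝ}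
    (hc : c ≤ 1 / 2) (F : X → ℝ≥0∞) :
    ∫⁻ x in {x : X | ∀ b ∈ S, ‖V x b - 1‖ < c}, F x ∂μ ≤
      ∫⁻ x in {x : X | ∀ b ∈ S, ‖(-Complex.I : ℂ) • mlog (V x b)‖ < 2 * c}, F x ∂μ :=
  lintegral_mono_set (region_subset_logCut V S hc)

/-- **LOG-CHARTED REFINEMENT** (print's `A′ ∈ 𝔤`): if the bond variables on `S` lie in a log-charted group `G` and
`c ≤ min(½, ρ_G)`, the enlarged region may be taken with `iA ∈ 𝔤`. [cite: Balaban1985UV3, (13) p.259] -/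
theorem region_subset_enlarged_lie (G : LogChart 𝔄) (V : X → β → 𝔄) (S : Set β) {c : ℝ} (hc : c ≤ 1 / 2)
    (hcρ : c ≤ G.ρ) (hG : ∀ x, ∀ b ∈ S, V x b ∈ G.carrier) :
    {x : X | ∀ b ∈ S, ‖V x b - 1‖ < c} ⊆
      {x : X | ∀ b ∈ S, ∃ A : 𝔄, (Complex.I : ℂ) • A ∈ G.lie ∧ exp ((Complex.I : ℂ) • A) = V x b ∧ ‖A‖ < 2 * c} := by
  intro x hx b hb
  refine ⟨(-Complex.I : ℂ) • mlog (V x b), ?_, enlarge_pointwise V hc hx b hb⟩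
  exact I_smul_logCoord_mem_lie G (hG x b hb) ((hx b hb).le.trans hcρ)

end Region

section RegionCStar

variable {X β 𝔄 : Type*} [CStarAlgebra 𝔄]

/-- **UNITARY REFINEMENT** (print's `G ⊂ U(N)`, `A′` hermitian): if the bond variables on `S` are unitary and `c ≤ ¼`,
the enlarged region may be taken with SELF-ADJOINT `A`. [cite: Balaban1985UV3, (13) p.259] -/
theorem region_subset_enlarged_selfAdjoint (V : X → β → 𝔄) (S : Set β) {c : ℝ} (hc : c ≤ 1 / 4)
    (hU : ∀ x, ∀ b ∈ S, V x b ∈ unitary 𝔄) :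
    {x : X | ∀ b ∈ S, ‖V x b - 1‖ < c} ⊆
      {x : X | ∀ b ∈ S, ∃ A : 𝔄, star A = A ∧ exp ((Complex.I : ℂ) • A) = V x b ∧ ‖A‖ < 2 * c} := by
  intro x hx b hb
  refine ⟨(-Complex.I : ℂ) • mlog (V x b), ?_, enlarge_pointwise V (by linarith) hx b hb⟩
  exact star_logCoord (hU x b hb) ((hx b hb).le.trans hc)

/-- the unitary refinement at the level of integrals. [cite: Balaban1985UV3, (13) p.259] -/
theorem lintegral_region_le_enlarged_selfAdjoint [MeasurableSpace X] (μ : Measure X) (V : X → β → 𝔄) (S : Set β)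
    {c : ℝ} (hc : c ≤ 1 / 4) (hU : ∀ x, ∀ b ∈ S, V x b ∈ unitary 𝔄) (F : X → ℝ≥0∞) :
    ∫⁻ x in {x : X | ∀ b ∈ S, ‖V x b - 1‖ < c}, F x ∂μ ≤
      ∫⁻ x in {x : X | ∀ b ∈ S, ∃ A : 𝔄, star A = A ∧ exp ((Complex.I : ℂ) • A) = V x b ∧ ‖A‖ < 2 * c}, F x ∂μ :=
  lintegral_mono_set (region_subset_enlarged_selfAdjoint V S hc hU)

end RegionCStar

/-! ## §3 The two B10 sentences end to end on the `ℤᵈ` block pairs (knit with `B10Eq13RegularityClaims`) -/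

section P259

variable {d : ℕ} {𝔸 : Type*} [NormedRing 𝔸] [NormOneClass 𝔸] [NormedAlgebra ℂ 𝔸] [CompleteSpace 𝔸]

/-- **p. 259 END TO END** (the bound of Lemma 1 of [6] + the enlargement): under the hypotheses of p29's `claim259`
(the field `U = U′U₁` and the background `U₁` on the block pair `B(y) ∪ B(y + Le_κ)` of `ℤᵈ`, plaquette bounds
`2B₃ε`, equal block axial trees and block averages — the `δ`'s of (13)) and «for g₀ sufficiently small» in the
explicit form `8d²L²B₃ε ≤ ½`: on every bond `b` of the pair the fluctuation variable `V′_b = (UU₁⁻¹)_b` IS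
`e^{iA′_b}`, `A′_b = (1/i) log V′_b`, with `|A′_b| < 16d²L²B₃ε` — the configuration lies in the region of
`χ′ = ∏ χ({|A′(b)| < 16·3²L²B₃g₀p(g₀)})` (`16d² = 16·3²` at `d = 3`, `ε = g₀p(g₀)`). [cite: Balaban1985UV3, (13) p.259] -/
theorem claim259_enlarged {L : ℕ} (hL : 1 ≤ L) {U U₁ : Site d → Fin d → 𝔸ˣ} {y : Site d} {κ : Fin d} {B₃ ε : ℝ}
    (hα : 0 < 2 * (L : ℝ) ^ 2 * B₃ * ε) (hsmall : 2 * (L : ℝ) ^ 2 * B₃ * ε ≤ 1 / (6 * ((d : ℝ) + 1)))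
    (hsmall' : 8 * (d : ℝ) ^ 2 * (L : ℝ) ^ 2 * B₃ * ε ≤ 1 / 2)
    (hU : ∀ x μ, U x μ ∈ U1 𝔸) (hU₁ : ∀ x μ, U₁ x μ ∈ U1 𝔸)
    (hPU : B8Lemma1NonAbelian.PlaqSmall U y (y + pairTop L κ) (2 * B₃ * ε))
    (hP1 : B8Lemma1NonAbelian.PlaqSmall U₁ y (y + pairTop L κ) (2 * B₃ * ε))
    (hax : ∀ r : Fin d → Fin L, axialFn U y (y + boxVec L r) = axialFn U₁ y (y + boxVec L r))
    (hax₁ : ∀ r : Fin d → Fin L, axialFn U (y + (L : ℤ) • e κ) (y + (L : ℤ) • e κ + boxVec L r)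
      = axialFn U₁ (y + (L : ℤ) • e κ) (y + (L : ℤ) • e κ + boxVec L r))
    (havg : bavg L U y κ = bavg L U₁ y κ)
    (x : Site d) (ν : Fin d) (hx : InPair L y κ x) (hxν : InPair L y κ (x + e ν)) :
    exp ((Complex.I : ℂ) • ((-Complex.I : ℂ) • mlog ((pert U U₁ x ν : 𝔸ˣ) : 𝔸))) = ((pert U U₁ x ν : 𝔸ˣ) : 𝔸) ∧
      ‖(-Complex.I : ℂ) • mlog ((pert U U₁ x ν : 𝔸ˣ) : 𝔸)‖ < 16 * (d : ℝ) ^ 2 * (L : ℝ) ^ 2 * B₃ * ε := by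
  have hb := claim259 hL hα hsmall hU hU₁ hPU hP1 hax hax₁ havg x ν hx hxν
  have h := exp_logCoord_and_norm_lt hb hsmall'
  refine ⟨h.1, ?_⟩
  have : 2 * (8 * (d : ℝ) ^ 2 * (L : ℝ) ^ 2 * B₃ * ε) = 16 * (d : ℝ) ^ 2 * (L : ℝ) ^ 2 * B₃ * ε := by ring
  linarith [h.2]

/-- **p. 259 at `d = 3`, the printed constants**: `|V′ − 1| < 8·3²L²B₃g₀p(g₀)` ⇒ `V′ = e^{iA′}`, `|A′| <
16·3²L²B₃g₀p(g₀)` (the one smallness `8·3²L²B₃ε ≤ ½` implies Lemma 1's threshold `2L²B₃ε ≤ 1/24`).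
[cite: Balaban1985UV3, (13) p.259] -/
theorem claim259_enlarged_d3 {L : ℕ} (hL : 1 ≤ L) {U U₁ : Site 3 → Fin 3 → 𝔸ˣ} {y : Site 3} {κ : Fin 3} {B₃ ε : ℝ}
    (hα : 0 < 2 * (L : ℝ) ^ 2 * B₃ * ε) (hsmall' : 8 * 3 ^ 2 * (L : ℝ) ^ 2 * B₃ * ε ≤ 1 / 2)
    (hU : ∀ x μ, U x μ ∈ U1 𝔸) (hU₁ : ∀ x μ, U₁ x μ ∈ U1 𝔸)
    (hPU : B8Lemma1NonAbelian.PlaqSmall U y (y + pairTop L κ) (2 * B₃ * ε))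
    (hP1 : B8Lemma1NonAbelian.PlaqSmall U₁ y (y + pairTop L κ) (2 * B₃ * ε))
    (hax : ∀ r : Fin 3 → Fin L, axialFn U y (y + boxVec L r) = axialFn U₁ y (y + boxVec L r))
    (hax₁ : ∀ r : Fin 3 → Fin L, axialFn U (y + (L : ℤ) • e κ) (y + (L : ℤ) • e κ + boxVec L r)
      = axialFn U₁ (y + (L : ℤ) • e κ) (y + (L : ℤ) • e κ + boxVec L r))
    (havg : bavg L U y κ = bavg L U₁ y κ)
    (x : Site 3) (ν : Fin 3) (hx : InPair L y κ x) (hxν : InPair L y κ (x + e ν)) :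
    exp ((Complex.I : ℂ) • ((-Complex.I : ℂ) • mlog ((pert U U₁ x ν : 𝔸ˣ) : 𝔸))) = ((pert U U₁ x ν : 𝔸ˣ) : 𝔸) ∧
      ‖(-Complex.I : ℂ) • mlog ((pert U U₁ x ν : 𝔸ˣ) : 𝔸)‖ < 16 * 3 ^ 2 * (L : ℝ) ^ 2 * B₃ * ε := by
  have h := claim259_enlarged (d := 3) hL hα (by norm_num at hsmall' ⊢; linarith) (by norm_num at hsmall' ⊢; linarith)
    hU hU₁ hPU hP1 hax hax₁ havg x ν hx hxν
  norm_num at h ⊢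
  exact h

/-- **p. 259 ON A LOG-CHARTED GROUP** (print's «semi-simple compact Lie group G» ⊂ U(N), `A′ ∈ 𝔤`): if moreover the
bond variables of `U` and `U₁` lie in a log-charted group `G` (so `V′_b = U_bU₁,b⁻¹ ∈ G`) and `8d²L²B₃ε ≤ ρ_G`, then
`iA′_b = log V′_b ∈ 𝔤`. [cite: Balaban1985UV3, (13) p.259] -/
theorem claim259_enlarged_lie (G : LogChart 𝔸) {L : ℕ} (hL : 1 ≤ L) {U U₁ : Site d → Fin d → 𝔸ˣ} {y : Site d}
    {κ : Fin d} {B₃ ε : ℝ}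
    (hα : 0 < 2 * (L : ℝ) ^ 2 * B₃ * ε) (hsmall : 2 * (L : ℝ) ^ 2 * B₃ * ε ≤ 1 / (6 * ((d : ℝ) + 1)))
    (hρ : 8 * (d : ℝ) ^ 2 * (L : ℝ) ^ 2 * B₃ * ε ≤ G.ρ)
    (hU : ∀ x μ, U x μ ∈ U1 𝔸) (hU₁ : ∀ x μ, U₁ x μ ∈ U1 𝔸)
    (hG : ∀ x μ, ((pert U U₁ x μ : 𝔸ˣ) : 𝔸) ∈ G.carrier)
    (hPU : B8Lemma1NonAbelian.PlaqSmall U y (y + pairTop L κ) (2 * B₃ * ε))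
    (hP1 : B8Lemma1NonAbelian.PlaqSmall U₁ y (y + pairTop L κ) (2 * B₃ * ε))
    (hax : ∀ r : Fin d → Fin L, axialFn U y (y + boxVec L r) = axialFn U₁ y (y + boxVec L r))
    (hax₁ : ∀ r : Fin d → Fin L, axialFn U (y + (L : ℤ) • e κ) (y + (L : ℤ) • e κ + boxVec L r)
      = axialFn U₁ (y + (L : ℤ) • e κ) (y + (L : ℤ) • e κ + boxVec L r))
    (havg : bavg L U y κ = bavg L U₁ y κ)
    (x : Site d) (ν : Fin d) (hx : InPair L y κ x) (hxν : InPair L y κ (x + e ν)) :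
    (Complex.I : ℂ) • ((-Complex.I : ℂ) • mlog ((pert U U₁ x ν : 𝔸ˣ) : 𝔸)) ∈ G.lie := by
  have hb := claim259 hL hα hsmall hU hU₁ hPU hP1 hax hax₁ havg x ν hx hxν
  exact I_smul_logCoord_mem_lie G (hG x ν) (hb.le.trans hρ)

end P259

section P259Unitary

variable {d : ℕ} {𝔸 : Type*} [CStarAlgebra 𝔸] [Nontrivial 𝔸]

/-- **p. 259 FOR UNITARY-VALUED FIELDS** (`G ⊂ U(N)`; the unitary group of a non-trivial C⋆-algebra): under the
hypotheses of p29's `claim259_unitary` and «g₀ sufficiently small» as `8d²L²B₃ε ≤ ¼`, on every bond of the pair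
`U′_b = e^{iA′_b}` with `A′_b = (1/i) log U′_b` SELF-ADJOINT and `|A′_b| < 16d²L²B₃ε`. [cite: Balaban1985UV3, (13) p.259] -/
theorem claim259_enlarged_unitary {L : ℕ} (hL : 1 ≤ L) {U₁ U' : Site d → Fin d → 𝔸ˣ}
    (hU₁ : ∀ x μ, U₁ x μ ∈ B7Prop2Explicit.unitaryUnits 𝔸) (hU' : ∀ x μ, U' x μ ∈ B7Prop2Explicit.unitaryUnits 𝔸)
    {y : Site d} {κ : Fin d} {B₃ ε : ℝ}
    (hα : 0 < 2 * (L : ℝ) ^ 2 * B₃ * ε) (hsmall : 2 * (L : ℝ) ^ 2 * B₃ * ε ≤ 1 / (6 * ((d : ℝ) + 1)))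
    (hsmall' : 8 * (d : ℝ) ^ 2 * (L : ℝ) ^ 2 * B₃ * ε ≤ 1 / 4)
    (hP1 : B8Lemma1NonAbelian.PlaqSmall U₁ y (y + pairTop L κ) (2 * B₃ * ε))
    (hPU : B8Lemma1NonAbelian.PlaqSmall (mulCfg U' U₁) y (y + pairTop L κ) (2 * B₃ * ε))
    (hax : ∀ r : Fin d → Fin L, axialFn (mulCfg U' U₁) y (y + boxVec L r) = axialFn U₁ y (y + boxVec L r))
    (hax₁ : ∀ r : Fin d → Fin L, axialFn (mulCfg U' U₁) (y + (L : ℤ) • e κ) (y + (L : ℤ) • e κ + boxVec L r)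
      = axialFn U₁ (y + (L : ℤ) • e κ) (y + (L : ℤ) • e κ + boxVec L r))
    (havg : bavg L (mulCfg U' U₁) y κ = bavg L U₁ y κ)
    (x : Site d) (ν : Fin d) (hx : InPair L y κ x) (hxν : InPair L y κ (x + e ν)) :
    exp ((Complex.I : ℂ) • ((-Complex.I : ℂ) • mlog ((U' x ν : 𝔸ˣ) : 𝔸))) = ((U' x ν : 𝔸ˣ) : 𝔸) ∧
      star ((-Complex.I : ℂ) • mlog ((U' x ν : 𝔸ˣ) : 𝔸)) = (-Complex.I : ℂ) • mlog ((U' x ν : 𝔸ˣ) : 𝔸) ∧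
      ‖(-Complex.I : ℂ) • mlog ((U' x ν : 𝔸ˣ) : 𝔸)‖ < 16 * (d : ℝ) ^ 2 * (L : ℝ) ^ 2 * B₃ * ε := by
  have hb := claim259_unitary hL hU₁ hU' hα hsmall hP1 hPU hax hax₁ havg x ν hx hxν
  have h := exp_logCoord_and_norm_lt hb (by linarith)
  refine ⟨h.1, star_logCoord (hU' x ν) (hb.le.trans hsmall'), ?_⟩
  have : 2 * (8 * (d : ℝ) ^ 2 * (L : ℝ) ^ 2 * B₃ * ε) = 16 * (d : ℝ) ^ 2 * (L : ℝ) ^ 2 * B₃ * ε := by ring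
  linarith [h.2]

end P259Unitary

section P268

variable {d : ℕ} {𝔸 : Type*} [NormedRing 𝔸] [NormOneClass 𝔸] [NormedAlgebra ℂ 𝔸] [CompleteSpace 𝔸]

/-- **p. 268 END TO END** (row B10.Eq49): under the hypotheses of p29's `claim268` (the fields `V_k` and `V^{(k)}` on
a block pair inside `B(Λ_{k+1})`, plaquette bounds `4B₃ε`, the `δ`-constraints of (49)) and «g_k sufficiently small»
as `16d²L²B₃ε ≤ ½`: every bond variable of `V′_k = V_k(V^{(k)})⁻¹` is `e^{iA′}` with `|A′| < 32d²L²B₃ε` — the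
configuration lies in the region of the `χ′` of p. 268 (`32d² = 32·3²` at `d = 3`, `ε = g_kp(g_k)`).
[cite: Balaban1985UV3, (49) p.268] -/
theorem claim268_enlarged {L : ℕ} (hL : 1 ≤ L) {Vk Vkk : Site d → Fin d → 𝔸ˣ} {y : Site d} {κ : Fin d} {B₃ ε : ℝ}
    (hα : 0 < 4 * (L : ℝ) ^ 2 * B₃ * ε) (hsmall : 4 * (L : ℝ) ^ 2 * B₃ * ε ≤ 1 / (6 * ((d : ℝ) + 1)))
    (hsmall' : 16 * (d : ℝ) ^ 2 * (L : ℝ) ^ 2 * B₃ * ε ≤ 1 / 2)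
    (hVk : ∀ x μ, Vk x μ ∈ U1 𝔸) (hVkk : ∀ x μ, Vkk x μ ∈ U1 𝔸)
    (hPk : B8Lemma1NonAbelian.PlaqSmall Vk y (y + pairTop L κ) (4 * B₃ * ε))
    (hPkk : B8Lemma1NonAbelian.PlaqSmall Vkk y (y + pairTop L κ) (4 * B₃ * ε))
    (hax : ∀ r : Fin d → Fin L, axialFn Vk y (y + boxVec L r) = axialFn Vkk y (y + boxVec L r))
    (hax₁ : ∀ r : Fin d → Fin L, axialFn Vk (y + (L : ℤ) • e κ) (y + (L : ℤ) • e κ + boxVec L r)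
      = axialFn Vkk (y + (L : ℤ) • e κ) (y + (L : ℤ) • e κ + boxVec L r))
    (havg : bavg L Vk y κ = bavg L Vkk y κ)
    (x : Site d) (ν : Fin d) (hx : InPair L y κ x) (hxν : InPair L y κ (x + e ν)) :
    exp ((Complex.I : ℂ) • ((-Complex.I : ℂ) • mlog ((pert Vk Vkk x ν : 𝔸ˣ) : 𝔸))) = ((pert Vk Vkk x ν : 𝔸ˣ) : 𝔸) ∧
      ‖(-Complex.I : ℂ) • mlog ((pert Vk Vkk x ν : 𝔸ˣ) : 𝔸)‖ < 32 * (d : ℝ) ^ 2 * (L : ℝ) ^ 2 * B₃ * ε := by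
  have hb := claim268 hL hα hsmall hVk hVkk hPk hPkk hax hax₁ havg x ν hx hxν
  have h := exp_logCoord_and_norm_lt hb hsmall'
  refine ⟨h.1, ?_⟩
  have : 2 * (16 * (d : ℝ) ^ 2 * (L : ℝ) ^ 2 * B₃ * ε) = 32 * (d : ℝ) ^ 2 * (L : ℝ) ^ 2 * B₃ * ε := by ring
  linarith [h.2]

/-- **p. 268 at `d = 3`, the printed constants**: `|V′_k − 1| < 16·3²L²B₃g_kp(g_k)` ⇒ `V′_k = e^{iA′}`, `|A′| <
32·3²L²B₃g_kp(g_k)` (the one smallness `16·3²L²B₃ε ≤ ½` implies Lemma 1's threshold `4L²B₃ε ≤ 1/24`).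
[cite: Balaban1985UV3, (49) p.268] -/
theorem claim268_enlarged_d3 {L : ℕ} (hL : 1 ≤ L) {Vk Vkk : Site 3 → Fin 3 → 𝔸ˣ} {y : Site 3} {κ : Fin 3} {B₃ ε : ℝ}
    (hα : 0 < 4 * (L : ℝ) ^ 2 * B₃ * ε) (hsmall' : 16 * 3 ^ 2 * (L : ℝ) ^ 2 * B₃ * ε ≤ 1 / 2)
    (hVk : ∀ x μ, Vk x μ ∈ U1 𝔸) (hVkk : ∀ x μ, Vkk x μ ∈ U1 𝔸)
    (hPk : B8Lemma1NonAbelian.PlaqSmall Vk y (y + pairTop L κ) (4 * B₃ * ε))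
    (hPkk : B8Lemma1NonAbelian.PlaqSmall Vkk y (y + pairTop L κ) (4 * B₃ * ε))
    (hax : ∀ r : Fin 3 → Fin L, axialFn Vk y (y + boxVec L r) = axialFn Vkk y (y + boxVec L r))
    (hax₁ : ∀ r : Fin 3 → Fin L, axialFn Vk (y + (L : ℤ) • e κ) (y + (L : ℤ) • e κ + boxVec L r)
      = axialFn Vkk (y + (L : ℤ) • e κ) (y + (L : ℤ) • e κ + boxVec L r))
    (havg : bavg L Vk y κ = bavg L Vkk y κ)
    (x : Site 3) (ν : Fin 3) (hx : InPair L y κ x) (hxν : InPair L y κ (x + e ν)) :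
    exp ((Complex.I : ℂ) • ((-Complex.I : ℂ) • mlog ((pert Vk Vkk x ν : 𝔸ˣ) : 𝔸))) = ((pert Vk Vkk x ν : 𝔸ˣ) : 𝔸) ∧
      ‖(-Complex.I : ℂ) • mlog ((pert Vk Vkk x ν : 𝔸ˣ) : 𝔸)‖ < 32 * 3 ^ 2 * (L : ℝ) ^ 2 * B₃ * ε := by
  have h := claim268_enlarged (d := 3) hL hα (by norm_num at hsmall' ⊢; linarith) (by norm_num at hsmall' ⊢; linarith)
    hVk hVkk hPk hPkk hax hax₁ havg x ν hx hxν
  norm_num at h ⊢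
  exact h

end P268

-- Axiom audit (scratch, not shipped): `#print axioms` of `lintegral_region_le_enlarged`, `claim259_enlarged_unitary`,
-- `claim268_enlarged_d3` = [propext, Classical.choice, Quot.sound].

end Literature.MathematicalPhysics.QuantumFieldTheory.Balaban1983to89.B10Eq13Enlargement
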